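import Mathlib
import HarnessLib
import Summits.Ventures.LatticeQCDFlow.Scaling.VarianceLaws
import Summits.Ventures.LatticeQCDFlow.Scoring.UStatisticVariance

/-!
# LatticeQCDFlow / Scoring — the two Hoeffding projections of an order-2 U-statistic,
# `0 ≤ 2ζ₁ ≤ ζ₂`, and the sandwich `4ζ₁/n ≤ Var U ≤ 2ζ₂/n`

HONEST FRAMING: exact (Metropolis-corrected) sampling algorithms for lattice gauge theory;
figures of merit are autocorrelation/cost numbers at stated couplings and volumes; no
continuum-physics claim.

Venture `LatticeQCDFlow` (cell pub-lqcd), sub-topic `Scoring`; FANOUT row 3 (`s0-u1-a`, S0-B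
implementation A, GEN-8).  Our finite-sum formalisation of a PUBLISHED fact — Hoeffding (1948,
Ann. Math. Statist. 19, 293–325, §5: `ζ₁ ≤ ζ₂/2` and `m²ζ₁/n ≤ Var U ≤ mζ_m/n`, here `m = 2`),
NAMED ONLY as the printed counterpart; NO definition is introduced (`varLaw`, `varLaw_nonneg`,
`varLaw_eq_sum_sq_dev` are row 29's `Scaling/VarianceLaws`).  Companion of row 3's
`Scoring/UStatisticVariance` (imported: the exact law
`Var U = (2(c₂ − μ²) + 4(n − 2)(c₁ − μ²))/(n(n − 1))`).

## Setting (finite `X`; law `q ≥ 0`, `Σ q = 1`; symmetric kernel `F`; `μ = Σ_xΣ_y q_x q_y F(x,y)`,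
## `h(x) = Σ_y q_y F(x,y)`, `c₁ = Σ_x q_x h(x)²`, `c₂ = Σ_xΣ_y q_x q_y F(x,y)²`, `ζ₁ = c₁ − μ²`,
## `ζ₂ = c₂ − μ²`; `U = Σ_{offDiag} F(φ_i, φ_j)/(n(n−1))` on `n ≥ 2` i.i.d. draws)

* `kernelMean_eq_sum_condMean` — `μ = Σ_x q_x h(x)`;
* **`condVar_nonneg`** — `μ² ≤ c₁` (`ζ₁ = Var_q h ≥ 0`);
* **`two_mul_condVar_le_kernelVar`** — `2(c₁ − μ²) ≤ c₂ − μ²` (`2ζ₁ ≤ ζ₂`): the residual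
  `G(x, y) = F(x, y) − h(x)` has `q⊗q`-second moment `c₂ − c₁`; by symmetry its conditional mean
  given `y` is `h(y) − μ`, whose `q`-second moment `c₁ − μ²` is at most that of `G` (Jensen in `x`
  for each `y`);
* **`variance_ustat₂_eq_leading_add`** — `E[(U − μ)²] = 4ζ₁/n + 2(ζ₂ − 2ζ₁)/(n(n − 1))` (leading
  i.i.d.-like term plus a non-negative correction; both non-increasing in `n`);
* **`variance_ustat₂_le`** — `E[(U − μ)²] ≤ 2ζ₂/n`; **`le_variance_ustat₂`** — `4ζ₁/n ≤ E[(U − μ)²]`.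
  (For the acceptance kernel `min(w, w′)`, `ζ₂ ≤ 1 − acc²` already halves the `4(1 − acc²)/n` of
  row 3's `Scoring/PairAcceptanceVariance`; the sharp envelope is in
  `Scoring/PairAcceptanceVarianceSharp`.)

NOT CLAIMED: higher-order kernels; the monotonicity of `n·Var U` in `n`; asymptotic normality;
anything measure-theoretic (finite sums only); nothing about any statistic of ours.
-/

namespace Summit.Ventures.LatticeQCDFlow.Scoring

open Finset
open Summit.Ventures.LatticeQCDFlow.Theory2

section Projections

variable {X : Type*} [Fintype X] {n : ℕ}

/-! ### The two projections and the sandwich -/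

/-- `μ = Σ_x q_x h(x)`: the kernel mean is the mean of the conditional mean. [folklore] -/
theorem kernelMean_eq_sum_condMean (q : X → ℝ) (F : X → X → ℝ) :
    ∑ x, ∑ y, q x * q y * F x y = ∑ x, q x * ∑ y, q y * F x y := by
  refine sum_congr rfl fun x _ => ?_
  rw [mul_sum]
  exact sum_congr rfl fun y _ => by ring

/-- **`ζ₁ ≥ 0`**: `μ² ≤ c₁`, i.e. `c₁ − μ² = Var_q h ≥ 0` (`q ≥ 0`, `Σ q = 1`). [folklore] -/
theorem condVar_nonneg (q : X → ℝ) (hq0 : ∀ x, 0 ≤ q x) (hq1 : ∑ x, q x = 1) (F : X → X → ℝ) :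
    (∑ x, ∑ y, q x * q y * F x y) ^ 2 ≤ ∑ x, q x * (∑ y, q y * F x y) ^ 2 := by
  have hv := varLaw_nonneg hq0 hq1 (fun x => ∑ y, q y * F x y)
  unfold varLaw at hv
  rw [kernelMean_eq_sum_condMean]
  linarith

/-- **`2ζ₁ ≤ ζ₂`** (the two Hoeffding projections are orthogonal): for `q ≥ 0`, `Σ q = 1` and a
symmetric kernel, `2(c₁ − μ²) ≤ c₂ − μ²`.  Proof: the residual `G(x, y) = F(x, y) − h(x)` has
`q⊗q`-second moment `c₂ − c₁`; its conditional mean given `y` is `h(y) − μ` (symmetry), whose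
`q`-second moment `c₁ − μ²` is at most that of `G` (Jensen in `x` for each `y`). [folklore] -/
theorem two_mul_condVar_le_kernelVar (q : X → ℝ) (hq0 : ∀ x, 0 ≤ q x) (hq1 : ∑ x, q x = 1)
    {F : X → X → ℝ} (hF : ∀ x y, F x y = F y x) :
    2 * ((∑ x, q x * (∑ y, q y * F x y) ^ 2) - (∑ x, ∑ y, q x * q y * F x y) ^ 2)
      ≤ (∑ x, ∑ y, q x * q y * F x y ^ 2) - (∑ x, ∑ y, q x * q y * F x y) ^ 2 := by
  set h : X → ℝ := fun x => ∑ y, q y * F x y with hh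
  set μ := ∑ x, ∑ y, q x * q y * F x y with hμdef
  have hμ : ∑ x, q x * h x = μ := (kernelMean_eq_sum_condMean q F).symm
  -- (1) the residual `G(x,y) = F(x,y) − h(x)` has second moment `c₂ − c₁`
  have h1 : ∑ x, ∑ y, q x * q y * (F x y - h x) ^ 2
      = (∑ x, ∑ y, q x * q y * F x y ^ 2) - ∑ x, q x * h x ^ 2 := by
    have row : ∀ x, ∑ y, q y * (F x y - h x) ^ 2 = (∑ y, q y * F x y ^ 2) - h x ^ 2 := by
      intro x
      have hv := varLaw_eq_sum_sq_dev hq1 (F x)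
      unfold varLaw at hv
      rw [← hv]
    have e : ∀ x, ∑ y, q x * q y * (F x y - h x) ^ 2 = q x * ((∑ y, q y * F x y ^ 2) - h x ^ 2) := by
      intro x
      rw [← row, mul_sum]
      exact sum_congr rfl fun y _ => by ring
    simp_rw [e, mul_sub]
    rw [sum_sub_distrib]
    congr 1
    refine sum_congr rfl fun x _ => ?_
    rw [mul_sum]
    exact sum_congr rfl fun y _ => by ring
  -- (2) by symmetry, the conditional mean of the residual given `y` is `h(y) − μ`
  have h2 : ∀ y, ∑ x, q x * (F x y - h x) = h y - μ := by
    intro y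
    simp_rw [mul_sub]
    rw [sum_sub_distrib, hμ]
    congr 1
    exact sum_congr rfl fun x _ => by rw [hF x y]
  -- (3) Jensen in `x` for each `y`, then sum over `y`
  have h3 : ∀ y, (h y - μ) ^ 2 ≤ ∑ x, q x * (F x y - h x) ^ 2 := by
    intro y
    have hv := varLaw_nonneg hq0 hq1 (fun x => F x y - h x)
    unfold varLaw at hv
    rw [h2 y] at hv
    linarith
  have h4 : ∑ y, q y * (h y - μ) ^ 2 = (∑ x, q x * h x ^ 2) - μ ^ 2 := by
    have hv := varLaw_eq_sum_sq_dev hq1 h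
    unfold varLaw at hv
    rw [hμ] at hv
    exact hv.symm
  have h5 : ∑ y, q y * (h y - μ) ^ 2 ≤ ∑ x, ∑ y, q x * q y * (F x y - h x) ^ 2 := by
    rw [sum_comm]
    refine sum_le_sum fun y _ => ?_
    calc q y * (h y - μ) ^ 2 ≤ q y * ∑ x, q x * (F x y - h x) ^ 2 :=
          mul_le_mul_of_nonneg_left (h3 y) (hq0 y)
      _ = ∑ x, q x * q y * (F x y - h x) ^ 2 := by
          rw [mul_sum]
          exact sum_congr rfl fun x _ => by ring
  rw [h4, h1] at h5
  show 2 * ((∑ x, q x * h x ^ 2) - μ ^ 2) ≤ (∑ x, ∑ y, q x * q y * F x y ^ 2) - μ ^ 2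
  linarith

/-- **Hoeffding's law rearranged**: `E[(U − μ)²] = 4ζ₁/n + 2(ζ₂ − 2ζ₁)/(n(n − 1))` — the i.i.d.-like
leading term plus a NON-NEGATIVE correction (`two_mul_condVar_le_kernelVar`); in particular
`n ↦ Var U_n` is the sum of two non-increasing functions of `n`. [folklore] -/
theorem variance_ustat₂_eq_leading_add (q : X → ℝ) (hq1 : ∑ x, q x = 1)
    {F : X → X → ℝ} (hF : ∀ x y, F x y = F y x) (hn : 2 ≤ n) :
    ∑ φ : Fin n → X, blockProd (fun _ => q) φ
        * ((∑ z ∈ (univ : Finset (Fin n)).offDiag, F (φ z.1) (φ z.2)) / (n * (n - 1))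
            - ∑ x, ∑ y, q x * q y * F x y) ^ 2
      = 4 * ((∑ x, q x * (∑ y, q y * F x y) ^ 2) - (∑ x, ∑ y, q x * q y * F x y) ^ 2) / n
        + 2 * (((∑ x, ∑ y, q x * q y * F x y ^ 2) - (∑ x, ∑ y, q x * q y * F x y) ^ 2)
            - 2 * ((∑ x, q x * (∑ y, q y * F x y) ^ 2) - (∑ x, ∑ y, q x * q y * F x y) ^ 2))
          / (n * (n - 1)) := by
  rw [variance_ustat₂_eq q hq1 hF hn]
  have h2 : (2 : ℝ) ≤ n := by exact_mod_cast hn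
  have hn0 : (n : ℝ) ≠ 0 := by positivity
  have hn1 : (n : ℝ) - 1 ≠ 0 := (by linarith : (0 : ℝ) < n - 1).ne'
  field_simp
  ring

/-- **Hoeffding's sandwich, upper half**: `E[(U − μ)²] ≤ 2ζ₂/n = 2(c₂ − μ²)/n`. [folklore] -/
theorem variance_ustat₂_le (q : X → ℝ) (hq0 : ∀ x, 0 ≤ q x) (hq1 : ∑ x, q x = 1)
    {F : X → X → ℝ} (hF : ∀ x y, F x y = F y x) (hn : 2 ≤ n) :
    ∑ φ : Fin n → X, blockProd (fun _ => q) φ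
        * ((∑ z ∈ (univ : Finset (Fin n)).offDiag, F (φ z.1) (φ z.2)) / (n * (n - 1))
            - ∑ x, ∑ y, q x * q y * F x y) ^ 2
      ≤ 2 * ((∑ x, ∑ y, q x * q y * F x y ^ 2) - (∑ x, ∑ y, q x * q y * F x y) ^ 2) / n := by
  rw [variance_ustat₂_eq q hq1 hF hn]
  have hproj := two_mul_condVar_le_kernelVar q hq0 hq1 hF
  have h2 : (2 : ℝ) ≤ n := by exact_mod_cast hn
  have hnpos : (0 : ℝ) < n := by linarith
  have hn1 : (0 : ℝ) < n - 1 := by linarith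
  rw [div_le_div_iff₀ (mul_pos hnpos hn1) hnpos]
  have h4 : (0 : ℝ) ≤ 2 * (n - 2) := by linarith
  nlinarith [mul_le_mul_of_nonneg_left hproj h4, mul_pos hnpos hn1]

/-- **Hoeffding's sandwich, lower half**: `4ζ₁/n = 4(c₁ − μ²)/n ≤ E[(U − μ)²]`. [folklore] -/
theorem le_variance_ustat₂ (q : X → ℝ) (hq0 : ∀ x, 0 ≤ q x) (hq1 : ∑ x, q x = 1)
    {F : X → X → ℝ} (hF : ∀ x y, F x y = F y x) (hn : 2 ≤ n) :
    4 * ((∑ x, q x * (∑ y, q y * F x y) ^ 2) - (∑ x, ∑ y, q x * q y * F x y) ^ 2) / n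
      ≤ ∑ φ : Fin n → X, blockProd (fun _ => q) φ
        * ((∑ z ∈ (univ : Finset (Fin n)).offDiag, F (φ z.1) (φ z.2)) / (n * (n - 1))
            - ∑ x, ∑ y, q x * q y * F x y) ^ 2 := by
  rw [variance_ustat₂_eq q hq1 hF hn]
  have hproj := two_mul_condVar_le_kernelVar q hq0 hq1 hF
  have h2 : (2 : ℝ) ≤ n := by exact_mod_cast hn
  have hnpos : (0 : ℝ) < n := by linarith
  have hn1 : (0 : ℝ) < n - 1 := by linarith
  rw [div_le_div_iff₀ hnpos (mul_pos hnpos hn1)]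
  nlinarith [mul_pos hnpos hn1]

end Projections

end Summit.Ventures.LatticeQCDFlow.Scoring
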